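import Summits.HodgeConjecture.HodgeConjecture.Theses.AffinePartDecay
import Summits.HodgeConjecture.HodgeConjecture.Theorems.AmpleAdicLefschetzWeakLefschetzInjective
import Literature.AlgebraicGeometry.HodgeTheory.ComplexOrientationFamily
import Literature.AlgebraicGeometry.HodgeTheory.SupportedHodgeClassDescent
import Literature.AlgebraicGeometry.HodgeTheory.AlgebraicClassesHodgeTypeHolds
import Literature.AlgebraicGeometry.HodgeTheory.HodgeTypePullback
import Literature.AlgebraicTopology.SingularHomology.GysinMapSupportProofs
import HarnessLib

/-!
# Line `birth` — BC3 skeleton for the crux `WeakLefschetzAlgebraicClasses` (stmt-HodgeConjecture-1968)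

Route `AffinePartDecay` (route-HodgeConjecture-AffinePartDecay), crux #2 `WeakLefschetzAlgebraicClasses`
(weak Lefschetz for ALGEBRAIC homological classes): for a closed immersion `i : H ⟶ X` of smooth
projective complex varieties, `dim X = n + 1`, `dim H = n`, with AFFINE complement `X ∖ i(H)`, and
`2p ≤ n`, a RATIONAL class `c ∈ H²ᵖ(X(ℂ); ℂ)` whose restriction `i^*c` lies in
`Alg^p(H) = Nᵖ H²ᵖ(H(ℂ); ℂ)` lies in `Alg^p(X)`.

THE LINE = GYSIN TRANSPORT + HODGE-TYPE REFLECTION + LEFSCHETZ DIVISION (the divisor form of the crux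
idea `lefschetz-division`, evidence `idea-lefschetz-division.md` on this item). Write
`L_H := i_* ∘ i^* : H²ᵖ(X(ℂ)) → H^{2p+2}(X(ℂ))` for the composite of the restriction with the REAL Gysin
morphism `i_* = complexGysin complexOrientationFamily` of the tree (Poincaré duality of the complex
orientation family is PROVED); `L_H x = x ∪ i_*1_H = x ∪ cl(H)` by the projection formula
(`complexGysin_cup`), i.e. `L_H` is the Lefschetz operator of the divisor class `[H] ∈ H²(X(ℂ))`.

* TRANSPORT (PROVED, used sorry-free in the glue): `i^*c ∈ Alg^p(H) ⇒ L_H c = i_*(i^*c) ∈ Alg^{p+1}(X)`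
  — proper push-forward preserves the coniveau: the tree's theorem `complexGysin_mem_algebraicClasses`
  (with the Borel–Moore base change `gysinMap_restrictCompl_eq_zero_of_field ℂ` and
  `hasPoincareDuality_complexOrientationFamily`).
* `stub_hodgeTypeReflected` — **HODGE TYPE IS REFLECTED ALONG `i^*` IN THE WEAK-LEFSCHETZ RANGE**
  (theorem-grade, size M on the tree's carriers): in the crux's setting, `i^*c ∈ Alg^p(H)` forces `c` to
  be of Hodge type `(p,p)` on `X`. Proof in print-form: `Alg^p(H) ⊆ H^{p,p}(H)` (the tree's theorem
  `isOfHodgeType_of_mem_algebraicClasses_of_isSmoothProjective`, Voisin I Prop. 11.20); `i^*` maps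
  `H^{a,b}(X)` to `H^{a,b}(H)` for every `(a,b)` (`IsOfHodgeType.map_of_le`, Voisin I §7.3.2); the Hodge
  decomposition of `H²ᵖ(H^an)` is DIRECT (`HodgeModel.isInternal_hodgePQ`), so the components `i^*c^{a,b}`,
  `(a,b) ≠ (p,p)`, of `i^*c ∈ H^{p,p}(H)` vanish; and `i^* : H²ᵖ(X(ℂ)) → H²ᵖ(H(ℂ))` is INJECTIVE for
  `2p ≤ n = dim X - 1` because `X ∖ i(H)` is ONE affine open (Andreotti–Frankel; the LANDED
  `Theorems.weakLefschetzInjective_proof` / `complexBettiMap_injective_of_affineCover` with `s = {X ∖ i(H)}`),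
  hence `c^{a,b} = 0` for `(a,b) ≠ (p,p)`. (Independence of the Hodge model:
  `hodgePQ_independent_of_hodgeModel_holds`; existence: `nonempty_hodgeModel_holds`.)
* `stub_lefschetzDivision` — **LEFSCHETZ DIVISION BY THE DIVISOR CLASS FOR RATIONAL HODGE CLASSES**
  (THE HARDEST STUB, open-problem grade, the cycle-theoretic heart): in the crux's setting, a RATIONAL
  class `c` of Hodge type `(p,p)`, `2p ≤ n`, with `L_H c = i_*i^*c ∈ Alg^{p+1}(X)` lies in `Alg^p(X)` —
  "an algebraic multiple `c ∪ [H]` of a Hodge class can be divided by `[H]` inside algebraic classes".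
  It is implied by the Hodge conjecture for `X` in degree `2p` (drop the `L_H` hypothesis), hence
  irrefutable short of a counterexample to HC; its CONTENT is the extra hypothesis: for `H` a member of
  the polarising system `|η|` it is the sub-middle, algebraic-input fragment of Grothendieck's
  `A(X, η)` ("`L x` algebraic ⇒ `x` algebraic", `x = Λ L x` below the middle), a consequence of the
  Lefschetz standard conjecture `B(X)` (Kleiman 1968 §2: `B ⇒ A`; tree decls `StandardConjectureA`,
  `StandardConjectureBStar`), KNOWN for abelian varieties (Lieberman 1968), flag varieties, products and
  smooth hyperplane sections of such, and holding unconditionally at the level of André's motivated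
  classes (`Λ` is motivated). First open instance: `p = 2`, `n = 4` (`X` a non-abelian fivefold).
* `weakLefschetz_of_pieces` — the REAL composition (sorry-free, standard axioms): Hodge type from
  REFLECTION, `L_H c ∈ Alg^{p+1}(X)` from TRANSPORT, conclusion from DIVISION. The crux statement is
  written out (unfolded one step) as its conclusion, so that `WeakLefschetzAlgebraicClasses_of` is the
  file's only theorem headed by the crux name (gate shape of `ledger skeleton check`).
* `WeakLefschetzAlgebraicClasses_of : WeakLefschetzAlgebraicClasses` — THE skeleton theorem: the crux
  BY NAME from the two declared stubs. Its only non-whitelisted axiom is the `sorryAx` of the stubs.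

`sorry` occurs ONLY in the two `stub_*` theorems.

Relation to the route and to prior crux work. In the route `AffinePartDecay` this crux is "what Hodge
at infinity buys below the middle degree"; its analytic engine (Grauert bundle on the Stein part,
prolongation across `H`) is untyped (no bundle carriers), so the typed skeleton is cohomological. The
refuter's cross-route glue (evidence `HodgeGlue.lean`, 2026-08-15: crux ⇐ `AmpleAdicLefschetz.ThickDescent`
∧ `WeakLefschetzInjective`) is NOT taken as the cut: `WeakLefschetzInjective` is now a theorem
(`Theorems.weakLefschetzInjective_proof`), so "∃ algebraic lift + injectivity" would leave one stub equal
to the crux modulo a proved theorem (costume). The sibling registrar skeleton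
`Cruxes/ThickDescent/Lines/birth.lean` (2026-08-17) cuts THICK as Gysin-kernel transversality + bare
`f_*f^*`-reflection (`∃ a` algebraic with `f_*f^*a = f_*f^*x`); the present cut is the DIVISOR form
specific to this crux: rationality and the Hodge type of `c` are kept INSIDE the division statement
(so it stays HC-implied even where `L_H` might fail to be injective — at the boundary degree `2p = n`
injectivity of `L_H` on `H^n(X)` is hard Lefschetz for the class `[H]` in degree `dim X - 1`, automatic
for ample `H` but not known to us for a divisor with merely affine complement), and the topological
input is the injectivity of `i^*` (landed) feeding a Hodge-type REFLECTION stub instead of a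
transversality stub. Idea `lefschetz-division` (planner-idea-node g8, 2026-08-16; DIV(X, η, p, 1) ⇐
`StandardConjectureA`) is the `H ∈ |mη|` case of `stub_lefschetzDivision`; delta: arbitrary smooth `H`
with affine complement, `L_H = i_*i^*` on the tree's real Gysin carrier, Hodge hypothesis explicit.

## Disproof used

No `Cruxes/WeakLefschetzAlgebraicClasses/Disproof.lean` exists at registration (2026-08-17; `ledger crux ls
stmt-HodgeConjecture-1968`: no workfiles; payload `disproof_path` absent); `ledger negatives --problem
HodgeConjecture` lists three refuted statements (MilnorK exponential symbol lift, Fermat K3 exhaustion,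
E-line transport matrix identity), none bearing on weak Lefschetz, Gysin morphisms or Lefschetz division.
Refuter record on the item (route-review 2026-08-15, three seats: implied by HC via Andreotti–Frankel
injectivity + Hodge-type reflection; implied by `B(X)`; first open `p = 2`, `dim X = 5`) is honoured:
stub 1 is exactly that reflection (theorem-grade), stub 2 is HC-implied; no stub is an instance of a
refuted statement; no landed Negative lemma (`Theorems/WeakLefschetzAlgebraicClasses/Negative/` absent).

## BC3 probes (registrar seat `planner-skel-stmt-HodgeConjecture-1968-0`, folder `bc/probe_*.lean`)

For each stub statement `S` (named `HodgeTypeReflected` / `LefschetzDivision` in the probe files):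
`example : S → WeakLefschetzAlgebraicClasses` and `example : S → HodgeConjecture` by
`first | exact? | simpa | aesop` under `set_option maxHeartbeats 400000` — all four must FAIL (results
quoted in `Lines/birth.md` and the seat's NOTES.md).

## References

* A. Grothendieck, *Standard conjectures on algebraic cycles*, Bombay Colloquium 1968, §3
  (`A(X)`, `B(X)`). [Grothendieck1969StandardConjectures]
* S. Kleiman, *Algebraic cycles and the Weil conjectures*, in: Dix exposés (1968), §2 (`B ⇒ A`,
  independence of the polarisation). [Kleiman1968AlgebraicCycles]
* D. Lieberman, *Numerical and homological equivalence of algebraic cycles on Hodge manifolds*,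
  Amer. J. Math. 90 (1968) 366–374 (`B` for abelian varieties). [Lieberman1968]
* Y. André, *Pour une théorie inconditionnelle des motifs*, Publ. Math. IHÉS 83 (1996), §0.2–0.3
  (motivated cycles; `*_L`, `Λ_L` motivated). [Andre1996Motifs]
* D. Patel, G. V. Ravindra, *Weak Lefschetz for Chow groups: infinitesimal lifting*, Homology Homotopy
  Appl. 16 (2014), Conj. 1.1–1.3 (pp. 65–66). [PatelRavindra2014]
* C. Voisin, *Hodge Theory and Complex Algebraic Geometry I* (2002), §7.3.2 (functoriality), Prop.
  11.20 (algebraic classes are Hodge); *II* (2003), Thm. 1.22–1.23 (Andreotti–Frankel, weak Lefschetz).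
  [VoisinHodgeI2002, VoisinHodgeII2003]
* W. Fulton, *Young Tableaux* (1997), App. B §B.1 (5)–(6) (Gysin homomorphism, projection formula).
  [FultonYoungTableaux1997]
-/

-- `Summit.<Summit>.<Problem>`: for the single-conjunct summit `HodgeConjecture` the duplicate component is mandated.
set_option linter.dupNamespace false
set_option linter.unusedVariables false

noncomputable section

namespace Summit.HodgeConjecture.HodgeConjecture.Cruxes.WeakLefschetzAlgebraicClasses.Birth

open CategoryTheory AlgebraicGeometry
open Literature.AlgebraicGeometry
open Literature.AlgebraicGeometry.Motives (SchemeOver IsSmoothProjective)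
open Literature.AlgebraicGeometry.HodgeTheory
open Literature.AlgebraicTopology.SingularHomology
open Summit.HodgeConjecture.HodgeConjecture.Theses.AffinePartDecay

/-! ## The two registered stubs -/

/-- **Stub 1 `stub_hodgeTypeReflected`** — HODGE TYPE IS REFLECTED ALONG `i^*` IN THE WEAK-LEFSCHETZ
RANGE: for a closed immersion `i : H ⟶ X` of smooth projective varieties (`dim X = n + 1`, `dim H = n`)
with affine complement and `2p ≤ n`, a class `c ∈ H²ᵖ(X(ℂ); ℂ)` whose restriction `i^*c` is ALGEBRAIC on
`H` is of Hodge type `(p,p)` on `X`. Why plausibly true: a theorem in print-form — `Alg^p(H) ⊆ H^{p,p}(H)`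
(`isOfHodgeType_of_mem_algebraicClasses_of_isSmoothProjective`), `i^*` preserves every Hodge type
(`IsOfHodgeType.map_of_le`) and the Hodge decomposition on `H` is direct (`HodgeModel.isInternal_hodgePQ`),
so the non-`(p,p)` components of `c` die under `i^*`, which is injective on `H²ᵖ` for `2p ≤ n` since
`X ∖ i(H)` is one affine open (the landed `Theorems.weakLefschetzInjective_proof`). Size M (Hodge components
of `c` in a fixed Hodge model of `X`, functoriality for each `(a,b)`, `hodgePQ_independent_of_hodgeModel_holds`).
[cite: VoisinHodgeI2002, §7.3.2 and Prop. 11.20] [cite: VoisinHodgeII2003, Thm. 1.23] -/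
theorem stub_hodgeTypeReflected :
    ∀ ⦃n p : ℕ⦄ ⦃X H : SchemeOver ℂ⦄ (i : H ⟶ X), IsSmoothProjective (n + 1) X → IsSmoothProjective n H →
      IsClosedImmersion i.left →
      (∀ U : X.left.Opens, (U : Set X.left) = (Set.range i.left.base)ᶜ → IsAffineOpen U) →
      2 * p ≤ n → ∀ (c : complexBetti X (2 * p)),
        complexBetti.map i (2 * p) c ∈ algebraicClasses H p →
        IsOfHodgeType (n + 1) X (2 * p) p p c := by
  sorry

/-- **Stub 2 `stub_lefschetzDivision`** — LEFSCHETZ DIVISION BY THE DIVISOR CLASS FOR RATIONAL HODGE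
CLASSES (THE HARDEST STUB, open-problem grade): in the crux's setting (`i : H ⟶ X` a closed immersion of
smooth projective varieties, `dim X = n + 1`, `dim H = n`, affine complement, `2p ≤ n`), a RATIONAL class
`c ∈ H²ᵖ(X(ℂ); ℂ)` of Hodge type `(p,p)` with `L_H c := i_*(i^*c) ∈ Alg^{p+1}(X)` (`i_*` the Gysin morphism
of `complexOrientationFamily`; `L_H = (· ∪ [H])` by the projection formula) lies in `Alg^p(X)`. Implied by
the Hodge conjecture for `X` in degree `2p` (so not refutable short of a counterexample to HC); its content
is division by `L_H` inside algebraic classes: for `H ∈ |mη|` the sub-middle algebraic-input fragment of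
`A(X, η)`, a consequence of `B(X)` (Kleiman), true for abelian varieties (Lieberman 1968), flag varieties
and at the motivated level (André 1996); first open instance `p = 2`, `n = 4`.
[cite: Grothendieck1969StandardConjectures, §3] [cite: Kleiman1968AlgebraicCycles, §2] [cite: Lieberman1968]
[cite: Andre1996Motifs, §0.2–0.3] [cite: PatelRavindra2014, Conj. 1.1–1.3] -/
theorem stub_lefschetzDivision :
    ∀ ⦃n p : ℕ⦄ ⦃X H : SchemeOver ℂ⦄ (i : H ⟶ X) (hX : IsSmoothProjective (n + 1) X)
      (hH : IsSmoothProjective n H), IsClosedImmersion i.left →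
      (∀ U : X.left.Opens, (U : Set X.left) = (Set.range i.left.base)ᶜ → IsAffineOpen U) →
      2 * p ≤ n → ∀ (hpq : 2 * p + 2 * (n + 1) = 2 * (p + 1) + 2 * n) (c : complexBetti X (2 * p)),
        HodgeTheory.IsRationalClass c → IsOfHodgeType (n + 1) X (2 * p) p p c →
        complexGysin complexOrientationFamily hH hX i hpq (complexBetti.map i (2 * p) c) ∈
          algebraicClasses X (p + 1) →
        c ∈ algebraicClasses X p := by
  sorry

/-! ## Sorry-free glue -/

/-- **The composition with explicit hypotheses** (the BC3 shape `stub₁-sig → stub₂-sig → crux`, with the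
crux `WeakLefschetzAlgebraicClasses` written out one step so that `WeakLefschetzAlgebraicClasses_of` below
is the file's only theorem headed by the crux name). REFLECTION (`hR`) gives the Hodge type `(p,p)` of `c`;
TRANSPORT gives `L_H c = i_*(i^*c) ∈ Alg^{p+1}(X)` (`complexGysin_mem_algebraicClasses`: proper push-forward
preserves the coniveau; Gysin degree `2(p+1)` since `dim X - dim H = 1`); DIVISION (`hD`) concludes.
Sorry-free; standard axioms. [cite: FultonYoungTableaux1997, Appendix B §B.1 (5)–(7)]
[cite: VoisinHodgeI2002, Prop. 11.20] -/
theorem weakLefschetz_of_pieces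
    (hR : ∀ ⦃n p : ℕ⦄ ⦃X H : SchemeOver ℂ⦄ (i : H ⟶ X), IsSmoothProjective (n + 1) X →
      IsSmoothProjective n H → IsClosedImmersion i.left →
      (∀ U : X.left.Opens, (U : Set X.left) = (Set.range i.left.base)ᶜ → IsAffineOpen U) →
      2 * p ≤ n → ∀ (c : complexBetti X (2 * p)),
        complexBetti.map i (2 * p) c ∈ algebraicClasses H p →
        IsOfHodgeType (n + 1) X (2 * p) p p c)
    (hD : ∀ ⦃n p : ℕ⦄ ⦃X H : SchemeOver ℂ⦄ (i : H ⟶ X) (hX : IsSmoothProjective (n + 1) X)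
      (hH : IsSmoothProjective n H), IsClosedImmersion i.left →
      (∀ U : X.left.Opens, (U : Set X.left) = (Set.range i.left.base)ᶜ → IsAffineOpen U) →
      2 * p ≤ n → ∀ (hpq : 2 * p + 2 * (n + 1) = 2 * (p + 1) + 2 * n) (c : complexBetti X (2 * p)),
        HodgeTheory.IsRationalClass c → IsOfHodgeType (n + 1) X (2 * p) p p c →
        complexGysin complexOrientationFamily hH hX i hpq (complexBetti.map i (2 * p) c) ∈
          algebraicClasses X (p + 1) →
        c ∈ algebraicClasses X p) :
    ∀ ⦃n p : ℕ⦄ ⦃X H : SchemeOver ℂ⦄ (i : H ⟶ X), IsSmoothProjective (n + 1) X →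
      IsSmoothProjective n H → IsClosedImmersion i.left →
      (∀ U : X.left.Opens, (U : Set X.left) = (Set.range i.left.base)ᶜ → IsAffineOpen U) →
      2 * p ≤ n → ∀ (c : complexBetti X (2 * p)), HodgeTheory.IsRationalClass c →
      complexBetti.map i (2 * p) c ∈ algebraicClasses H p → c ∈ algebraicClasses X p := by
  intro n p X H i hX hH hi hU hp c hc halg
  -- the Gysin degree: `dim X - dim H = 1`, so `i_* : H²ᵖ(H(ℂ)) → H^{2(p+1)}(X(ℂ))`
  have hpq : 2 * p + 2 * (n + 1) = 2 * (p + 1) + 2 * n := by ring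
  -- reflection: `c` is of Hodge type `(p,p)`
  have hHodge : IsOfHodgeType (n + 1) X (2 * p) p p c := hR i hX hH hi hU hp c halg
  -- transport: `L_H c = i_*(i^* c)` is algebraic on `X`
  have hG : complexGysin complexOrientationFamily hH hX i hpq (complexBetti.map i (2 * p) c) ∈
      algebraicClasses X (p + 1) :=
    complexGysin_mem_algebraicClasses (gysinMap_restrictCompl_eq_zero_of_field ℂ)
      complexOrientationFamily hasPoincareDuality_complexOrientationFamily hH hX i (by omega) hpq halg
  -- division
  exact hD i hX hH hi hU hp hpq c hc hHodge hG

/-! ## The skeleton theorem: the crux BY NAME from the two declared stubs -/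

/-- **THE SKELETON THEOREM.** The crux
`Summit.HodgeConjecture.HodgeConjecture.Theses.AffinePartDecay.WeakLefschetzAlgebraicClasses`, concluded
BY NAME from the two DECLARED stubs (the only `sorry`s of the file) through the sorry-free composition
`weakLefschetz_of_pieces`. [cite: PatelRavindra2014, Conj. 1.1] [cite: Kleiman1968AlgebraicCycles, §2] -/
theorem WeakLefschetzAlgebraicClasses_of :
    Summit.HodgeConjecture.HodgeConjecture.Theses.AffinePartDecay.WeakLefschetzAlgebraicClasses :=
  weakLefschetz_of_pieces stub_hodgeTypeReflected stub_lefschetzDivision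

end Summit.HodgeConjecture.HodgeConjecture.Cruxes.WeakLefschetzAlgebraicClasses.Birth

end
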